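import Mathlib
import Summits.ValiantsHypothesis.ValiantsHypothesis.Theorems.GrenetZeonPolySizeQPAlgebraSquareZeroBlock
import Summits.ValiantsHypothesis.ValiantsHypothesis.Theorems.GrenetZeonPolySizeQPAlgebraJetDeterminant
import HarnessLib

/-!
# Crux `GrenetZeon.PolySizeQPAlgebra` (stmt-ValiantsHypothesis-8064), line `vbp-slice-dealg` —
# second-order expansion of an affine determinant at `diag(1_κ, S)` for a residual block `S` of ANY size

`…ResidualCorankTwo` settles the type-independent local Hessian bound at residual corank `≤ 2`; the
remaining input `LocalHessianBound₃` (`…LocalReductionResidualThree`) concerns points whose value matrix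
is `≃ diag(1_k, S)` with `S ∈ Mat_q(𝔪)`, `q ≥ 3`.  Every analysis of such points (the inequalities
`AL(q)` / conjecture G of the hand memos, or type-specific counts such as `ℂ[x,y]/(x²,y²)` at the rung
`(n, 4)`) starts from the closed form of the Hessian of `λ(det A)` at the block normal form, proved here for
every `q` with no hypothesis on `det S`:

* `det_fromBlocks_sqz`, `det_fromBlocks_sqz_map(')` — the Schur step over any commutative ring with
  `ε² = η² = 0`: `det (fromBlocks (1+εX₁₁+ηY₁₁) (εX₁₂+ηY₁₂) (εX₂₁+ηY₂₁) (S+εX₂₂+ηY₂₂))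
   = (1 + ε trX₁₁)(1 + η trY₁₁)(1 - εη tr(X₁₁Y₁₁)) · det (S + εX₂₂ + ηY₂₂ - εη(X₂₁Y₁₂ + Y₂₁X₁₂))`.
* `eval_pderiv_pderiv_det_blockNormalForm_general` — **the closed form**: for affine `A` with
  `A(x) = diag(1_κ, S)`, `X = ∂_s A(x)`, `Y = ∂_t A(x)` in blocks,
  `∂_s∂_t det A (x) = tr(adj S·(-(X₂₁Y₁₂+Y₂₁X₁₂))) + Σ_r Σ_{q≠r} det(S | row r ← (Y₂₂)_r, row q ← (X₂₂)_q)
     + trX₁₁·tr(adj S·Y₂₂) + trY₁₁·tr(adj S·X₂₂) + (trX₁₁·trY₁₁ - tr(X₁₁Y₁₁))·det S`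
  (the memo's `T₃+T₄`, `T₅`, `T₁`, `T₂`, and a `det S`-multiple vanishing on the hypersurface).  For
  `S ∈ Mat_q(𝔪)` the coefficients of `T₁…T₄` are `(q-1)`-minors (`∈ 𝔪^{q-1}`) and those of `T₅` are
  `(q-2)`-minors (`∈ 𝔪^{q-2}`) — the starting point of the residual-corank-`q` rank counts.

HONEST FRAMING: formal calculus; no stub of the line is closed; VP ≠ VNP is not moved.

References: T. Mignon, N. Ressayre, IMRN 2004:79, §2 [MignonRessayre2004].
-/

noncomputable section

open MvPolynomial Matrix
open Literature.Computability.AlgebraicComplexity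

-- single-conjunct layout `Summits/ValiantsHypothesis/ValiantsHypothesis`: duplicated namespace by design
set_option linter.dupNamespace false

namespace Summit.ValiantsHypothesis.ValiantsHypothesis.Theorems.GrenetZeonPolySizeQPAlgebra

/-! ### The Schur step for a residual block of any size -/

section SchurGeneral

variable {T R : Type*} [CommRing T] [CommRing R] {ε η : T} {κ m : Type*} [Fintype κ] [DecidableEq κ]
  [Fintype m] [DecidableEq m]

/-- **Schur step at `diag(1_κ, S)`, `S` of any size**, over a commutative ring with `ε² = η² = 0`:
`det (fromBlocks (1 + εX₁₁ + ηY₁₁) (εX₁₂ + ηY₁₂) (εX₂₁ + ηY₂₁) (S + εX₂₂ + ηY₂₂))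
  = (1 + ε tr X₁₁)(1 + η tr Y₁₁)(1 - εη tr(X₁₁Y₁₁)) · det (S + εX₂₂ + ηY₂₂ - εη (X₂₁Y₁₂ + Y₂₁X₁₂))`
(`Matrix.det_fromBlocks₁₁`, the unipotent block inverted by `1 - E + E²`). [cite: MignonRessayre2004, §2] -/
theorem det_fromBlocks_sqz (hε : ε * ε = 0) (hη : η * η = 0) (S : Matrix m m T)
    (X₁₁ Y₁₁ : Matrix κ κ T) (X₁₂ Y₁₂ : Matrix κ m T) (X₂₁ Y₂₁ : Matrix m κ T) (X₂₂ Y₂₂ : Matrix m m T) :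
    (Matrix.fromBlocks (1 + (ε • X₁₁ + η • Y₁₁)) (ε • X₁₂ + η • Y₁₂) (ε • X₂₁ + η • Y₂₁)
        (S + (ε • X₂₂ + η • Y₂₂))).det =
      (1 + ε * X₁₁.trace) * (1 + η * Y₁₁.trace) * (1 - ε * η * (X₁₁ * Y₁₁).trace) *
        (S + (ε • X₂₂ + η • Y₂₂) - (ε * η) • (X₂₁ * Y₁₂ + Y₂₁ * X₁₂)).det := by
  set E : Matrix κ κ T := ε • X₁₁ + η • Y₁₁ with hE
  have hE3 : E * E * E = 0 := by
    rw [hE, sqz_mul_sqz hε hη, epsEta_smul_mul_sqz hε hη]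
  letI : Invertible (1 + E) := ⟨1 - E + E * E,
    by rw [show (1 - E + E * E) * (1 + E) = 1 + E * E * E by noncomm_ring, hE3, add_zero],
    by rw [show (1 + E) * (1 - E + E * E) = 1 + E * E * E by noncomm_ring, hE3, add_zero]⟩
  have hinv : ⅟(1 + E) = 1 - E + E * E := rfl
  rw [Matrix.det_fromBlocks₁₁, hinv]
  have hcorr : (ε • X₂₁ + η • Y₂₁) * (1 - E + E * E) * (ε • X₁₂ + η • Y₁₂) =
      (ε * η) • (X₂₁ * Y₁₂ + Y₂₁ * X₁₂) := by
    have h1 : (ε • X₂₁ + η • Y₂₁) * E = (ε * η) • (X₂₁ * Y₁₁ + Y₂₁ * X₁₁) := by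
      rw [hE, sqz_mul_sqz hε hη]
    have h2 : (ε • X₂₁ + η • Y₂₁) * (1 - E + E * E) =
        ε • X₂₁ + η • Y₂₁ - (ε * η) • (X₂₁ * Y₁₁ + Y₂₁ * X₁₁) := by
      rw [Matrix.mul_add, Matrix.mul_sub, Matrix.mul_one, ← Matrix.mul_assoc, h1, hE,
        epsEta_smul_mul_sqz hε hη, add_zero]
    rw [h2, Matrix.sub_mul, epsEta_smul_mul_sqz hε hη, sub_zero, sqz_mul_sqz hε hη]
  rw [hcorr, hE, det_one_add_sqz hε hη, add_sub_assoc]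

/-- The same read through a ring map `c : R → T` (all blocks images of matrices over `R`).
[cite: MignonRessayre2004, §2] -/
theorem det_fromBlocks_sqz_map (c : R →+* T) (hε : ε * ε = 0) (hη : η * η = 0) (S : Matrix m m R)
    (X₁₁ Y₁₁ : Matrix κ κ R) (X₁₂ Y₁₂ : Matrix κ m R) (X₂₁ Y₂₁ : Matrix m κ R) (X₂₂ Y₂₂ : Matrix m m R) :
    (Matrix.fromBlocks (1 + (ε • X₁₁.map c + η • Y₁₁.map c)) (ε • X₁₂.map c + η • Y₁₂.map c)
        (ε • X₂₁.map c + η • Y₂₁.map c) (S.map c + (ε • X₂₂.map c + η • Y₂₂.map c))).det =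
      (1 + ε * c X₁₁.trace) * (1 + η * c Y₁₁.trace) * (1 - ε * η * c (X₁₁ * Y₁₁).trace) *
        (S.map c + (ε • X₂₂.map c + η • Y₂₂.map c) - (ε * η) • (X₂₁ * Y₁₂ + Y₂₁ * X₁₂).map c).det := by
  have htrκ : ∀ N : Matrix κ κ R, (N.map c).trace = c N.trace := fun N =>
    (AddMonoidHom.map_trace (c : R →+* T).toAddMonoidHom N).symm
  have hmadd : ∀ M N : Matrix m m R, (M + N).map c = M.map c + N.map c := fun M N =>
    Matrix.map_add c (map_add c) M N
  rw [det_fromBlocks_sqz hε hη, ← Matrix.map_mul, htrκ, htrκ, htrκ, ← Matrix.map_mul, ← Matrix.map_mul,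
    ← hmadd]

/-- Variant with the second-order correction written as `+ εη · c(-(X₂₁Y₁₂ + Y₂₁X₁₂))`.
[cite: MignonRessayre2004, §2] -/
theorem det_fromBlocks_sqz_map' (c : R →+* T) (hε : ε * ε = 0) (hη : η * η = 0) (S : Matrix m m R)
    (X₁₁ Y₁₁ : Matrix κ κ R) (X₁₂ Y₁₂ : Matrix κ m R) (X₂₁ Y₂₁ : Matrix m κ R) (X₂₂ Y₂₂ : Matrix m m R) :
    (Matrix.fromBlocks (1 + (ε • X₁₁.map c + η • Y₁₁.map c)) (ε • X₁₂.map c + η • Y₁₂.map c)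
        (ε • X₂₁.map c + η • Y₂₁.map c) (S.map c + (ε • X₂₂.map c + η • Y₂₂.map c))).det =
      (1 + ε * c X₁₁.trace) * (1 + η * c Y₁₁.trace) * (1 - ε * η * c (X₁₁ * Y₁₁).trace) *
        (S.map c + ε • X₂₂.map c + η • Y₂₂.map c +
          (ε * η) • (-(X₂₁ * Y₁₂ + Y₂₁ * X₁₂)).map c).det := by
  rw [det_fromBlocks_sqz_map c hε hη, Matrix.map_neg c (map_neg c), smul_neg, ← sub_eq_add_neg, add_assoc]

end SchurGeneral

/-! ### Second partials of an affine determinant at `diag(1_κ, S)`, `S` of any size -/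

section BlockGeneral

variable {σ : Type*} [DecidableEq σ] {R : Type*} [CommRing R] {κ m : Type*} [Fintype κ] [DecidableEq κ]
  [Fintype m] [DecidableEq m]

set_option maxHeartbeats 400000 in
/-- **`∂_s ∂_t det A (x)` at a point where `A(x) = diag(1_κ, S)`, `S ∈ Mat_m(R)` of ANY size** (no
hypothesis on `det S`).  With `X = ∂_s A(x)`, `Y = ∂_t A(x)` in blocks:
`∂_s∂_t det A (x) = [tr(adj S · (-(X₂₁Y₁₂ + Y₂₁X₁₂))) + Σ_r Σ_{q≠r} det(S | row r ← (Y₂₂)_r, row q ← (X₂₂)_q)]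
   + tr X₁₁ · tr(adj S · Y₂₂) + tr Y₁₁ · tr(adj S · X₂₂) + (tr X₁₁ · tr Y₁₁ - tr(X₁₁Y₁₁)) · det S`
— the general-corank form of `eval_pderiv_pderiv_det_blockNormalForm` (there `m = Fin 2`, `det S = 0`).
The four groups are the memo's `T₃+T₄`, `T₅` (second polarisation of `det` at `S`), `T₁, T₂`, and the
`det S`-multiple that vanishes on the hypersurface. [cite: MignonRessayre2004, §2] -/
theorem eval_pderiv_pderiv_det_blockNormalForm_general (x : σ → R) (s t : σ)
    (A : Matrix (κ ⊕ m) (κ ⊕ m) (MvPolynomial σ R)) (hA : ∀ i j, (A i j).totalDegree ≤ 1)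
    (S : Matrix m m R) (hB : A.map (eval x) = Matrix.fromBlocks 1 0 0 S)
    (X Y : Matrix (κ ⊕ m) (κ ⊕ m) R) (hX : (A.map fun a => eval x (pderiv s a)) = X)
    (hY : (A.map fun a => eval x (pderiv t a)) = Y) :
    eval x (pderiv s (pderiv t A.det)) =
      (S.adjugate * -(X.toBlocks₂₁ * Y.toBlocks₁₂ + Y.toBlocks₂₁ * X.toBlocks₁₂)).trace +
        (∑ r, ∑ q, if q = r then 0 else
          ((S.updateRow r (Y.toBlocks₂₂ r)).updateRow q (X.toBlocks₂₂ q)).det) +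
        X.toBlocks₁₁.trace * (S.adjugate * Y.toBlocks₂₂).trace +
        Y.toBlocks₁₁.trace * (S.adjugate * X.toBlocks₂₂).trace +
        (X.toBlocks₁₁.trace * Y.toBlocks₁₁.trace - (X.toBlocks₁₁ * Y.toBlocks₁₁).trace) * S.det := by
  rw [eval_pderiv_pderiv_det_eq_jet x s t A hA, hB, hX, hY]
  have hM : (Matrix.fromBlocks 1 0 0 S : Matrix _ _ R).map (algebraMap R (DualNumber (DualNumber R))) + (DualNumber.eps : DualNumber (DualNumber R)) • X.map (algebraMap R (DualNumber (DualNumber R))) + (algebraMap (DualNumber R) (DualNumber (DualNumber R)) DualNumber.eps) • Y.map (algebraMap R (DualNumber (DualNumber R))) =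
      Matrix.fromBlocks (1 + ((DualNumber.eps : DualNumber (DualNumber R)) • X.toBlocks₁₁.map (algebraMap R (DualNumber (DualNumber R))) + (algebraMap (DualNumber R) (DualNumber (DualNumber R)) DualNumber.eps) • Y.toBlocks₁₁.map (algebraMap R (DualNumber (DualNumber R)))))
        ((DualNumber.eps : DualNumber (DualNumber R)) • X.toBlocks₁₂.map (algebraMap R (DualNumber (DualNumber R))) + (algebraMap (DualNumber R) (DualNumber (DualNumber R)) DualNumber.eps) • Y.toBlocks₁₂.map (algebraMap R (DualNumber (DualNumber R))))
        ((DualNumber.eps : DualNumber (DualNumber R)) • X.toBlocks₂₁.map (algebraMap R (DualNumber (DualNumber R))) + (algebraMap (DualNumber R) (DualNumber (DualNumber R)) DualNumber.eps) • Y.toBlocks₂₁.map (algebraMap R (DualNumber (DualNumber R))))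
        (S.map (algebraMap R (DualNumber (DualNumber R))) + ((DualNumber.eps : DualNumber (DualNumber R)) • X.toBlocks₂₂.map (algebraMap R (DualNumber (DualNumber R))) + (algebraMap (DualNumber R) (DualNumber (DualNumber R)) DualNumber.eps) • Y.toBlocks₂₂.map (algebraMap R (DualNumber (DualNumber R))))) := by
    conv_lhs => rw [← Matrix.fromBlocks_toBlocks X, ← Matrix.fromBlocks_toBlocks Y]
    rw [Matrix.fromBlocks_map, Matrix.fromBlocks_map, Matrix.fromBlocks_map, Matrix.fromBlocks_smul,
      Matrix.fromBlocks_smul, Matrix.fromBlocks_add, Matrix.fromBlocks_add,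
      Matrix.map_one (algebraMap R (DualNumber (DualNumber R))) (map_zero (algebraMap R (DualNumber (DualNumber R)))) (map_one (algebraMap R (DualNumber (DualNumber R)))), Matrix.map_zero (algebraMap R (DualNumber (DualNumber R))) (map_zero (algebraMap R (DualNumber (DualNumber R)))),
      Matrix.map_zero (algebraMap R (DualNumber (DualNumber R))) (map_zero (algebraMap R (DualNumber (DualNumber R)))), zero_add, zero_add, add_assoc, add_assoc]
  rw [hM]
  have h := det_fromBlocks_sqz_map' (algebraMap R (DualNumber (DualNumber R)))
    (ε := (DualNumber.eps : DualNumber (DualNumber R)))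
    (η := (algebraMap (DualNumber R) (DualNumber (DualNumber R)) DualNumber.eps))
    eps_mul_eps_jet eta_mul_eta_jet S
    X.toBlocks₁₁ Y.toBlocks₁₁ X.toBlocks₁₂ Y.toBlocks₁₂ X.toBlocks₂₁ Y.toBlocks₂₁ X.toBlocks₂₂ Y.toBlocks₂₂
  have h' : (Matrix.fromBlocks (1 + ((DualNumber.eps : DualNumber (DualNumber R)) • X.toBlocks₁₁.map (algebraMap R (DualNumber (DualNumber R))) + (algebraMap (DualNumber R) (DualNumber (DualNumber R)) DualNumber.eps) • Y.toBlocks₁₁.map (algebraMap R (DualNumber (DualNumber R)))))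
        ((DualNumber.eps : DualNumber (DualNumber R)) • X.toBlocks₁₂.map (algebraMap R (DualNumber (DualNumber R))) + (algebraMap (DualNumber R) (DualNumber (DualNumber R)) DualNumber.eps) • Y.toBlocks₁₂.map (algebraMap R (DualNumber (DualNumber R))))
        ((DualNumber.eps : DualNumber (DualNumber R)) • X.toBlocks₂₁.map (algebraMap R (DualNumber (DualNumber R))) + (algebraMap (DualNumber R) (DualNumber (DualNumber R)) DualNumber.eps) • Y.toBlocks₂₁.map (algebraMap R (DualNumber (DualNumber R))))
        (S.map (algebraMap R (DualNumber (DualNumber R))) + ((DualNumber.eps : DualNumber (DualNumber R)) • X.toBlocks₂₂.map (algebraMap R (DualNumber (DualNumber R))) + (algebraMap (DualNumber R) (DualNumber (DualNumber R)) DualNumber.eps) • Y.toBlocks₂₂.map (algebraMap R (DualNumber (DualNumber R)))))).det =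
      (1 + (DualNumber.eps : DualNumber (DualNumber R)) * (algebraMap R (DualNumber (DualNumber R))) X.toBlocks₁₁.trace) * (1 + (algebraMap (DualNumber R) (DualNumber (DualNumber R)) DualNumber.eps) * (algebraMap R (DualNumber (DualNumber R))) Y.toBlocks₁₁.trace) *
        (1 - (DualNumber.eps : DualNumber (DualNumber R)) * (algebraMap (DualNumber R) (DualNumber (DualNumber R)) DualNumber.eps) * (algebraMap R (DualNumber (DualNumber R))) (X.toBlocks₁₁ * Y.toBlocks₁₁).trace) *
        (S.map (algebraMap R (DualNumber (DualNumber R))) + (DualNumber.eps : DualNumber (DualNumber R)) • X.toBlocks₂₂.map (algebraMap R (DualNumber (DualNumber R))) + (algebraMap (DualNumber R) (DualNumber (DualNumber R)) DualNumber.eps) • Y.toBlocks₂₂.map (algebraMap R (DualNumber (DualNumber R))) +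
          ((DualNumber.eps : DualNumber (DualNumber R)) * (algebraMap (DualNumber R) (DualNumber (DualNumber R)) DualNumber.eps)) • (-(X.toBlocks₂₁ * Y.toBlocks₁₂ + Y.toBlocks₂₁ * X.toBlocks₁₂)).map (algebraMap R (DualNumber (DualNumber R)))).det := h
  obtain ⟨v1, v2, v3, v4⟩ := det_sqz_jet_components S X.toBlocks₂₂ Y.toBlocks₂₂
    (-(X.toBlocks₂₁ * Y.toBlocks₁₂ + Y.toBlocks₂₁ * X.toBlocks₁₂))
  rw [h', snd_snd_mul]
  rw [v1, v2, v3, v4]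
  simp only [TrivSqZeroExt.fst_add, TrivSqZeroExt.snd_add, TrivSqZeroExt.fst_sub, TrivSqZeroExt.snd_sub,
    TrivSqZeroExt.fst_one, TrivSqZeroExt.snd_one, snd_snd_mul, fst_fst_mul, fst_snd_mul, snd_fst_mul,
    eps_jet_components, eta_jet_components, algebraMap_jet_components,
    TrivSqZeroExt.fst_zero, TrivSqZeroExt.snd_zero]
  ring

end BlockGeneral

end Summit.ValiantsHypothesis.ValiantsHypothesis.Theorems.GrenetZeonPolySizeQPAlgebra

end
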